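import Literature.Analysis.FluidPDE.MollifiedWeakEuler
import Literature.Analysis.FunctionSpaces.SpaceTimeMollifierBounds
import HarnessLib

/-!
# The space–time mollification of a bounded Hölder field: derivatives as mollifications, and
# the sup bounds of Buckmaster–Vicol (2.12)–(2.14)

Analysis/FluidPDE support file (serves the discharge of
`Literature.Barriers.AnomalousDissipation.BuckmasterVicol2019_mollifiedEulerStart`; Buckmaster–Vicol,
Ann. of Math. 189 (2019), §2.5: for `u ∈ C^{β̄}_{t,x}` and `v_n = (u ∗ₓ φ_{λ⁻¹}) ∗ₜ ϕ_{λ⁻¹}`,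
(2.12) `‖R̊_n‖_{C⁰} ≲ λ_n^{-1} M_u + λ_n^{-2β̄} M_u²` (commutator estimate of Constantin–E–Titi),
(2.13) `‖R̊_n‖_{C¹_{t,x}} ≲ M_u + λ_n^{1-2β̄} M_u²`, (2.14) `‖v_n‖_{C¹_{t,x}} ≲ λ_n^{1-β̄} M_u`).

For admissible data `W : ℝ → T^d → ℝ^d` — bounded, strongly measurable, vanishing off a time slab —
every first and second derivative of `V = Torus.mollifiedField φ ε W` is again a space–time
mollification `timeAvgWith r (s ↦ Wᵢ(s) ⋆ κ)` with `r ∈ {ρ, ρ'}` (`ρ = φ.normed`) and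
`κ ∈ {k_ε, ∂ⱼk_ε, ∂ₗ∂ⱼk_ε}` (`Torus.partialDeriv_mollifiedField_apply`, `…timeDeriv…`,
`…partialDeriv_partialDeriv…`, `…timeDeriv_partialDeriv…`); applied to `W = U` and to the columns
`W = Uⱼ U` of `U ⊗ U` (the mollified flux `Torus.mollifiedFlux` of `MollifiedWeakEuler`) and
combined with the window bound of `SpaceTimeMollifierBounds`, this gives, for `U` bounded by
`M` and `β`-Hölder with constant `H` on the slab (`Torus.HolderSlabData`), time kernel
`ρ_τ = (timeBump hτ).normed`, `0 < ε ≤ 1/4`, `m = max τ ε`, at every `(t, x)` whose window lies in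
the slab:

* `|Vᵢ| ≤ M`, `|Vᵢ - Uᵢ(t, x)| ≤ H m^β`, `|Vᵢ(t, x) - Vᵢ(t, x')| ≤ H ‖x - x'‖^β`;
* `|∂ⱼVᵢ| ≤ C₁ ε⁻¹ H m^β` (`∫ ∂ⱼk_ε = 0` re-centres), `|∂ₜVᵢ| ≤ c τ⁻¹ M`, `|∂ₗ∂ⱼVᵢ| ≤ C₂ ε⁻² M`,
  `|∂ₜ∂ⱼVᵢ| ≤ c τ⁻¹ C₁ ε⁻¹ M`;
* `|𝒯ⱼᵢ - VᵢVⱼ| ≤ 4 M H m^β` (CET re-centring `𝒯ⱼᵢ - VᵢVⱼ = ℳ(UᵢUⱼ - VᵢVⱼ)`, to first order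
  in the modulus, which is all (2.12)'s use in Thm. 1.3 needs), `|∂ₗ𝒯ⱼᵢ| ≤ C₁ ε⁻¹ M²`,
  `|∂ₜ𝒯ⱼᵢ| ≤ c τ⁻¹ M²`

(`C₁ = Torus.gradProfileMass d`, `C₂ = Torus.derivProfileMass d 2`, `c = Torus.timeBumpDerivMass`).

## Mathlib / tree search

Tree, reused: `mollifiedField_apply_eq_timeAvgWith`, `timeDeriv_mollifiedField_apply`,
`hasDerivAt_mollifiedField_apply` (`OnsagerProofs`), `Torus.partialDeriv_convolution_timeAvgWith`,
`Torus.timeAvgWith_convolution`, `Torus.hasDerivAt_timeAvgWith` (`TorusTimeAverage`),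
`Torus.partialDeriv_apply_coord` (`TorusEnstrophyOrthogonality`), and the bounds/kernels of
`SpaceTimeMollifierBounds`. Nothing restated; one hypothesis structure (`Torus.HolderSlabData`,
CONVENTIONS §9) and no named facts.

## References

* T. Buckmaster, V. Vicol, Ann. of Math. 189 (2019), §2.5 (2.12)–(2.14). [`BuckmasterVicol2019Annals`]
* P. Constantin, W. E, E. S. Titi, Comm. Math. Phys. 165 (1994), (6)–(7).
-/

noncomputable section

open MeasureTheory TopologicalSpace Set Function Filter Metric ContinuousLinearMap
open _root_.Topology
open scoped ENNReal NNReal Convolution InnerProductSpace ContDiff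

namespace Literature.Analysis.FluidPDE

namespace Torus

open FunctionSpaces.Torus (stLift lift kernel IsSmooth IsContDiff IsDivFree mollifiedField vecMollify
  timeBump timeBumpDerivMass gradProfileMass derivProfileMass)
open FunctionSpaces (timeAvgWith)

variable {d : Type*} [Fintype d] [DecidableEq d]

/-! ## Admissible data and the derivatives of its mollification as mollifications -/

section Identify

variable {W : ℝ → UnitAddTorus d → EuclideanSpace ℝ d} {φ : ContDiffBump (0 : ℝ)} {ε A T₀ : ℝ}

omit [DecidableEq d] in
/-- Fibres `s ↦ (Wᵢ(s) ⋆ κ)(x)` of bounded measurable data against a continuous kernel are locally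
integrable in time. [folklore] -/
theorem locallyIntegrable_convolution_fibre (hWm : StronglyMeasurable (uncurry W))
    (hWb : ∀ s y, ‖W s y‖ ≤ A) (i : d) {κ : UnitAddTorus d → ℝ} (hκ : Continuous κ)
    (x : UnitAddTorus d) :
    LocallyIntegrable (fun s => ((fun y => W s y i) ⋆ κ) x) volume := by
  have hm : StronglyMeasurable (uncurry fun s x => ((fun y => W s y i) ⋆ κ) x) :=
    stronglyMeasurable_uncurry_convolution (stronglyMeasurable_uncurry_apply hWm i) hκ
  have hb : ∀ s, ‖((fun y => W s y i) ⋆ κ) x‖ ≤ A * ∫ y, ‖κ y‖ := fun s =>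
    norm_convolution_le_of_bound (fun y => (PiLp.norm_apply_le (W s y) i).trans (hWb s y)) hκ x
  have hmeas : AEStronglyMeasurable (fun s => ((fun y => W s y i) ⋆ κ) x) volume :=
    (hm.comp_measurable (measurable_id.prodMk measurable_const)).aestronglyMeasurable
  refine (locallyIntegrable_iff).2 fun K hK => ?_
  exact Integrable.mono' (integrableOn_const (hs := hK.measure_lt_top.ne)) hmeas.restrict
    (Eventually.of_forall fun s => hb s)

omit [DecidableEq d] in
/-- Coordinates of the mollified field as functions: `Vᵢ(t) = (timeAvgWith ρ Wᵢ t) ⋆ k_ε`. [folklore] -/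
theorem mollifiedField_apply_fun (φ : ContDiffBump (0 : ℝ)) (ε : ℝ) (W : ℝ → UnitAddTorus d → EuclideanSpace ℝ d)
    (t : ℝ) (i : d) :
    (fun y => mollifiedField φ ε W t y i) =
      (timeAvgWith (φ.normed volume) (fun s y => W s y i) t) ⋆ kernel ε := by
  funext y
  rw [FunctionSpaces.Torus.mollifiedField_apply]

variable (hWm : StronglyMeasurable (uncurry W)) (hWb : ∀ s y, ‖W s y‖ ≤ A)
  (hW0 : ∀ s, s ∉ Icc 0 T₀ → W s = 0) (hε : 0 < ε) (hε' : ε ≤ 1 / 4)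
include hWm hWb hW0 hε hε'

/-- **Space derivatives of the mollified field are mollifications by `∂ⱼk_ε`**:
`∂ⱼVᵢ(t, x) = timeAvgWith ρ (s ↦ Wᵢ(s) ⋆ ∂ⱼk_ε) t x`. [folklore] -/
theorem partialDeriv_mollifiedField_apply (t : ℝ) (x : UnitAddTorus d) (j i : d) :
    FunctionSpaces.Torus.partialDeriv j (mollifiedField φ ε W t) x i =
      timeAvgWith (φ.normed volume) (fun s => (fun y => W s y i) ⋆
        FunctionSpaces.Torus.partialDeriv j (kernel ε)) t x := by
  have hWi : Integrable (uncurry W) ((volume : Measure ℝ).prod volume) :=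
    integrable_uncurry_of_bounded hWm hWb hW0
  have hV : IsSmooth (mollifiedField φ ε W t) := isSmooth_mollifiedField hWi hε hε' t
  rw [← FunctionSpaces.Torus.partialDeriv_apply_coord (hV.isContDiff (by simp)) j x i,
    mollifiedField_apply_fun φ ε W t i,
    FunctionSpaces.Torus.partialDeriv_convolution_timeAvgWith (FunctionSpaces.Torus.integrable_uncurry_apply hWi i)
      φ.continuous_normed φ.hasCompactSupport_normed (FunctionSpaces.Torus.isSmooth_kernel hε hε') t j]

/-- The space derivative of the mollified field, coordinate by coordinate, as a function:
`(∂ⱼV(t))ᵢ = (timeAvgWith ρ Wᵢ t) ⋆ ∂ⱼk_ε`. [folklore] -/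
theorem partialDeriv_mollifiedField_apply_fun (t : ℝ) (j i : d) :
    (fun y => FunctionSpaces.Torus.partialDeriv j (mollifiedField φ ε W t) y i) =
      (timeAvgWith (φ.normed volume) (fun s y => W s y i) t) ⋆
        FunctionSpaces.Torus.partialDeriv j (kernel ε) := by
  have hWi : Integrable (uncurry W) ((volume : Measure ℝ).prod volume) :=
    integrable_uncurry_of_bounded hWm hWb hW0
  funext y
  rw [partialDeriv_mollifiedField_apply hWm hWb hW0 hε hε',
    FunctionSpaces.Torus.timeAvgWith_convolution (FunctionSpaces.Torus.integrable_uncurry_apply hWi i)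
      φ.continuous_normed φ.hasCompactSupport_normed
      ((FunctionSpaces.Torus.isSmooth_kernel hε hε').partialDeriv j).continuous t]

/-- **Second space derivatives**: `∂ₗ∂ⱼVᵢ(t, x) = timeAvgWith ρ (s ↦ Wᵢ(s) ⋆ ∂ₗ∂ⱼk_ε) t x`. [folklore] -/
theorem partialDeriv_partialDeriv_mollifiedField_apply (t : ℝ) (x : UnitAddTorus d) (l j i : d) :
    FunctionSpaces.Torus.partialDeriv l (FunctionSpaces.Torus.partialDeriv j (mollifiedField φ ε W t)) x i =
      timeAvgWith (φ.normed volume) (fun s => (fun y => W s y i) ⋆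
        FunctionSpaces.Torus.partialDeriv l (FunctionSpaces.Torus.partialDeriv j (kernel ε))) t x := by
  have hWi : Integrable (uncurry W) ((volume : Measure ℝ).prod volume) :=
    integrable_uncurry_of_bounded hWm hWb hW0
  have hV : IsSmooth (mollifiedField φ ε W t) := isSmooth_mollifiedField hWi hε hε' t
  have hdV : IsSmooth (FunctionSpaces.Torus.partialDeriv j (mollifiedField φ ε W t)) := hV.partialDeriv j
  rw [← FunctionSpaces.Torus.partialDeriv_apply_coord (hdV.isContDiff (by simp)) l x i,
    partialDeriv_mollifiedField_apply_fun hWm hWb hW0 hε hε' t j i,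
    FunctionSpaces.Torus.partialDeriv_convolution_timeAvgWith (FunctionSpaces.Torus.integrable_uncurry_apply hWi i)
      φ.continuous_normed φ.hasCompactSupport_normed
      ((FunctionSpaces.Torus.isSmooth_kernel hε hε').partialDeriv j) t l]

/-- **Time derivative of the space derivative**:
`∂ₜ(∂ⱼV)ᵢ(t, x) = timeAvgWith ρ' (s ↦ Wᵢ(s) ⋆ ∂ⱼk_ε) t x`. [folklore] -/
theorem hasDerivAt_partialDeriv_mollifiedField_apply (t : ℝ) (x : UnitAddTorus d) (j i : d) :
    HasDerivAt (fun τ => FunctionSpaces.Torus.partialDeriv j (mollifiedField φ ε W τ) x i)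
      (timeAvgWith (deriv (φ.normed volume)) (fun s => (fun y => W s y i) ⋆
        FunctionSpaces.Torus.partialDeriv j (kernel ε)) t x) t := by
  have hfun : (fun τ => FunctionSpaces.Torus.partialDeriv j (mollifiedField φ ε W τ) x i) =
      fun τ => timeAvgWith (φ.normed volume) (fun s => (fun y => W s y i) ⋆
        FunctionSpaces.Torus.partialDeriv j (kernel ε)) τ x :=
    funext fun τ => partialDeriv_mollifiedField_apply hWm hWb hW0 hε hε' τ x j i
  rw [hfun]
  exact FunctionSpaces.Torus.hasDerivAt_timeAvgWith (φ.contDiff_normed (μ := volume) (n := 1))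
    φ.hasCompactSupport_normed
    (locallyIntegrable_convolution_fibre hWm hWb i
      ((FunctionSpaces.Torus.isSmooth_kernel hε hε').partialDeriv j).continuous x) t

/-- The vector time derivative of the space derivative of the mollified field. [folklore] -/
theorem timeDeriv_partialDeriv_mollifiedField_apply (t : ℝ) (x : UnitAddTorus d) (j i : d) :
    FunctionSpaces.Torus.timeDeriv (fun τ y => FunctionSpaces.Torus.partialDeriv j (mollifiedField φ ε W τ) y) t x i =
      timeAvgWith (deriv (φ.normed volume)) (fun s => (fun y => W s y i) ⋆
        FunctionSpaces.Torus.partialDeriv j (kernel ε)) t x := by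
  have h := hasDerivAt_of_apply fun i => hasDerivAt_partialDeriv_mollifiedField_apply (φ := φ) hWm hWb hW0 hε hε' t x j i
  rw [FunctionSpaces.Torus.timeDeriv, h.deriv]

end Identify

/-! ## Bounded Hölder data on a time slab -/

section Data

/-- **Bounded Hölder data on a time slab** (the hypotheses of Buckmaster–Vicol 2019, Thm. 1.3 on
`u ∈ C^{β̄}_{t,x}(T³ × [-2T, 2T])`, after extension by zero): a field `U : ℝ → T^d → ℝ^d` that is
strongly measurable on `ℝ × T^d`, bounded by `M`, vanishes off the slab `[0, T₀]`, and is
`β`-Hölder with constant `H` on the slab for the sup (max) space–time distance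
(`0 < β ≤ 1`, `0 ≤ H`). [cite: BuckmasterVicol2019Annals, Thm. 1.3 and §2.5] -/
structure HolderSlabData (U : ℝ → UnitAddTorus d → EuclideanSpace ℝ d) (M H β T₀ : ℝ) : Prop where
  /-- joint strong measurability on `ℝ × T^d` -/
  measurable : StronglyMeasurable (uncurry U)
  /-- the sup bound `‖U‖ ≤ M` -/
  bound : ∀ s y, ‖U s y‖ ≤ M
  /-- `U` vanishes off the time slab `[0, T₀]` -/
  zero_off : ∀ s, s ∉ Icc 0 T₀ → U s = 0
  /-- the space–time Hölder bound on the slab (sup distance on `ℝ × T^d`) -/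
  holder : ∀ s ∈ Icc 0 T₀, ∀ s' ∈ Icc 0 T₀, ∀ y y' : UnitAddTorus d,
    ‖U s y - U s' y'‖ ≤ H * max |s - s'| ‖y - y'‖ ^ β
  /-- the Hölder constant is nonnegative -/
  H_nonneg : 0 ≤ H
  /-- the Hölder exponent is positive -/
  β_pos : 0 < β
  /-- the Hölder exponent is at most one -/
  β_le_one : β ≤ 1

variable {U : ℝ → UnitAddTorus d → EuclideanSpace ℝ d} {M H β T₀ : ℝ}

omit [DecidableEq d] in
/-- The sup bound is nonnegative. [folklore] -/
theorem HolderSlabData.M_nonneg (hU : HolderSlabData U M H β T₀) : 0 ≤ M :=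
  (norm_nonneg _).trans (hU.bound 0 0)

omit [DecidableEq d] in
/-- Coordinates of the data are bounded by `M`. [folklore] -/
theorem HolderSlabData.bound_apply (hU : HolderSlabData U M H β T₀) (i : d) (s : ℝ) (y : UnitAddTorus d) :
    ‖U s y i‖ ≤ M :=
  (PiLp.norm_apply_le (U s y) i).trans (hU.bound s y)

omit [DecidableEq d] in
/-- **The Hölder modulus on a window.** If the `τ`-window of `t` lies in the slab, then for
`|s - t| ≤ τ` and `‖y - x‖ ≤ ε`, `‖U(s, y) - U(t, x)‖ ≤ H (max τ ε)^β`. [folklore] -/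
theorem HolderSlabData.norm_sub_le_of_window (hU : HolderSlabData U M H β T₀) {τ ε t : ℝ}
    (ht : Icc (t - τ) (t + τ) ⊆ Icc 0 T₀) (hτ : 0 ≤ τ) {s : ℝ} {x y : UnitAddTorus d} (hs : |s - t| ≤ τ)
    (hy : ‖y - x‖ ≤ ε) : ‖U s y - U t x‖ ≤ H * max τ ε ^ β := by
  have hsI : s ∈ Icc 0 T₀ := ht ⟨by linarith [(abs_le.1 hs).1], by linarith [(abs_le.1 hs).2]⟩
  have htI : t ∈ Icc 0 T₀ := ht ⟨by linarith, by linarith⟩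
  refine (hU.holder s hsI t htI y x).trans (mul_le_mul_of_nonneg_left ?_ hU.H_nonneg)
  exact Real.rpow_le_rpow (le_max_of_le_left (abs_nonneg _)) (max_le_max hs hy) hU.β_pos.le

omit [DecidableEq d] in
/-- Coordinate form of the window modulus. [folklore] -/
theorem HolderSlabData.norm_apply_sub_le_of_window (hU : HolderSlabData U M H β T₀) {τ ε t : ℝ}
    (ht : Icc (t - τ) (t + τ) ⊆ Icc 0 T₀) (hτ : 0 ≤ τ) {s : ℝ} {x y : UnitAddTorus d} (hs : |s - t| ≤ τ)
    (hy : ‖y - x‖ ≤ ε) (i : d) : ‖U s y i - U t x i‖ ≤ H * max τ ε ^ β := by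
  have h := hU.norm_sub_le_of_window ht hτ hs hy
  exact le_trans (by rw [← PiLp.sub_apply]; exact PiLp.norm_apply_le _ i) h

omit [DecidableEq d] in
/-- **Spatial translates**: `‖U(s, y) - U(s, y + δ)‖ ≤ H ‖δ‖^β` for every `s` (on the slab by
the Hölder bound, off it both terms vanish). [folklore] -/
theorem HolderSlabData.norm_sub_translate_le (hU : HolderSlabData U M H β T₀) (s : ℝ)
    (y δ : UnitAddTorus d) : ‖U s y - U s (y + δ)‖ ≤ H * ‖δ‖ ^ β := by
  by_cases hs : s ∈ Icc 0 T₀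
  · have h := hU.holder s hs s hs y (y + δ)
    rw [sub_self, abs_zero, sub_add_cancel_left, norm_neg, max_eq_right (norm_nonneg _)] at h
    exact h
  · rw [hU.zero_off s hs]
    simp only [Pi.zero_apply, sub_self, norm_zero]
    exact mul_nonneg hU.H_nonneg (Real.rpow_nonneg (norm_nonneg _) _)

end Data

/-! ## The sup bounds -/

section Bounds

variable {U : ℝ → UnitAddTorus d → EuclideanSpace ℝ d} {M H β T₀ τ ε : ℝ}

omit [DecidableEq d] in
/-- **`|Vᵢ| ≤ M`**: the mollified field is bounded by the sup of the data. [folklore] -/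
theorem norm_mollifiedField_apply_le (hU : HolderSlabData U M H β T₀) (hτ : 0 < τ) (hε : 0 < ε)
    (hε' : ε ≤ 1 / 4) (t : ℝ) (x : UnitAddTorus d) (i : d) :
    ‖mollifiedField (timeBump hτ) ε U t x i‖ ≤ M := by
  have hUi : Integrable (uncurry U) ((volume : Measure ℝ).prod volume) :=
    integrable_uncurry_of_bounded hU.measurable hU.bound hU.zero_off
  rw [mollifiedField_apply_eq_timeAvgWith hUi hε hε']
  have h := FunctionSpaces.Torus.norm_timeAvgWith_convolution_le_of_bound (hU.bound_apply i)
    (timeBump hτ).integrable_normed (FunctionSpaces.Torus.continuous_kernel hε hε') t x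
  rwa [FunctionSpaces.Torus.integral_norm_timeBump_normed, FunctionSpaces.Torus.integral_norm_kernel_eq_one hε hε',
    one_mul, one_mul] at h

omit [DecidableEq d] in
/-- **`|Vᵢ(t, x) - Uᵢ(t, x)| ≤ H (max τ ε)^β`** on windows inside the slab (re-centre at
`Uᵢ(t, x)` and apply the window bound). [folklore] -/
theorem norm_mollifiedField_apply_sub_le (hU : HolderSlabData U M H β T₀) (hτ : 0 < τ) (hε : 0 < ε)
    (hε' : ε ≤ 1 / 4) {t : ℝ} (ht : Icc (t - τ) (t + τ) ⊆ Icc 0 T₀) (x : UnitAddTorus d) (i : d) :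
    ‖mollifiedField (timeBump hτ) ε U t x i - U t x i‖ ≤ H * max τ ε ^ β := by
  have hUi : Integrable (uncurry U) ((volume : Measure ℝ).prod volume) :=
    integrable_uncurry_of_bounded hU.measurable hU.bound hU.zero_off
  have hk := FunctionSpaces.Torus.continuous_kernel (d := d) hε hε'
  rw [mollifiedField_apply_eq_timeAvgWith hUi hε hε']
  -- re-centre
  have hsub := FunctionSpaces.Torus.timeAvgWith_convolution_sub_const (stronglyMeasurable_uncurry_apply hU.measurable i)
    (hU.bound_apply i) (timeBump hτ).integrable_normed hk (U t x i) t x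
  rw [(timeBump hτ).integral_normed, FunctionSpaces.Torus.integral_kernel hε hε', mul_one, mul_one] at hsub
  rw [← hsub]
  -- window bound
  have h := FunctionSpaces.Torus.norm_timeAvgWith_convolution_le_of_window
    (h := fun s y => U s y i - U t x i) (timeBump hτ).integrable_normed
    (fun σ hσ => (FunctionSpaces.Torus.timeBump_normed_eq_zero hτ hσ).1) hk
    (fun z hz => FunctionSpaces.Torus.kernel_eq_zero_of_lt hε hz) (t := t) (x := x) (B := H * max τ ε ^ β)
    (fun s y hs hy => hU.norm_apply_sub_le_of_window ht hτ.le hs hy i)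
  rwa [FunctionSpaces.Torus.integral_norm_timeBump_normed, FunctionSpaces.Torus.integral_norm_kernel_eq_one hε hε',
    one_mul, one_mul] at h

/-- **`|∂ⱼVᵢ| ≤ C₁ ε⁻¹ H (max τ ε)^β`** on windows inside the slab: `∂ⱼVᵢ = ℳ_{ρ, ∂ⱼk}(Uᵢ - Uᵢ(t,x))`
since `∫ ∂ⱼk_ε = 0`, then the window bound with `∫|∂ⱼk_ε| ≤ C₁ ε⁻¹` (Buckmaster–Vicol (2.14):
`‖v_n‖_{C¹} ≲ λ^{1-β̄} M_u`). [cite: BuckmasterVicol2019Annals, §2.5 (2.14)] -/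
theorem norm_partialDeriv_mollifiedField_apply_le (hU : HolderSlabData U M H β T₀) (hτ : 0 < τ)
    (hε : 0 < ε) (hε' : ε ≤ 1 / 4) {t : ℝ} (ht : Icc (t - τ) (t + τ) ⊆ Icc 0 T₀) (x : UnitAddTorus d)
    (j i : d) :
    ‖FunctionSpaces.Torus.partialDeriv j (mollifiedField (timeBump hτ) ε U t) x i‖ ≤
      ε⁻¹ * gradProfileMass d * (H * max τ ε ^ β) := by
  have hk : IsSmooth (kernel (d := d) ε) := FunctionSpaces.Torus.isSmooth_kernel hε hε'
  have hκ : Continuous (FunctionSpaces.Torus.partialDeriv j (kernel (d := d) ε)) := (hk.partialDeriv j).continuous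
  rw [partialDeriv_mollifiedField_apply hU.measurable hU.bound hU.zero_off hε hε']
  -- re-centre: the constant costs nothing since `∫ ∂ⱼk_ε = 0`
  have hsub := FunctionSpaces.Torus.timeAvgWith_convolution_sub_const (stronglyMeasurable_uncurry_apply hU.measurable i)
    (hU.bound_apply i) (timeBump hτ).integrable_normed hκ (U t x i) t x
  rw [FunctionSpaces.Torus.integral_partialDeriv_kernel hε hε', mul_zero, mul_zero, sub_zero] at hsub
  rw [← hsub]
  have h := FunctionSpaces.Torus.norm_timeAvgWith_convolution_le_of_window
    (h := fun s y => U s y i - U t x i) (timeBump hτ).integrable_normed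
    (fun σ hσ => (FunctionSpaces.Torus.timeBump_normed_eq_zero hτ hσ).1) hκ
    (fun z hz => FunctionSpaces.Torus.partialDeriv_kernel_eq_zero hε hε' j hz) (t := t) (x := x)
    (B := H * max τ ε ^ β) (fun s y hs hy => hU.norm_apply_sub_le_of_window ht hτ.le hs hy i)
  rw [FunctionSpaces.Torus.integral_norm_timeBump_normed, one_mul] at h
  refine h.trans (mul_le_mul_of_nonneg_right (FunctionSpaces.Torus.integral_norm_partialDeriv_kernel_le hε hε' j) ?_)
  exact mul_nonneg hU.H_nonneg (Real.rpow_nonneg (le_max_of_le_left hτ.le) _)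

omit [DecidableEq d] in
/-- **`|∂ₜVᵢ| ≤ c τ⁻¹ M`** (`∂ₜVᵢ = ℳ_{ρ', k} Uᵢ`, `∫|ρ_τ'| = c τ⁻¹`). [cite: BuckmasterVicol2019Annals, §2.5 (2.14)] -/
theorem norm_timeDeriv_mollifiedField_apply_le (hU : HolderSlabData U M H β T₀) (hτ : 0 < τ)
    (hε : 0 < ε) (hε' : ε ≤ 1 / 4) (t : ℝ) (x : UnitAddTorus d) (i : d) :
    ‖FunctionSpaces.Torus.timeDeriv (mollifiedField (timeBump hτ) ε U) t x i‖ ≤ τ⁻¹ * timeBumpDerivMass * M := by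
  have hUi : Integrable (uncurry U) ((volume : Measure ℝ).prod volume) :=
    integrable_uncurry_of_bounded hU.measurable hU.bound hU.zero_off
  rw [timeDeriv_mollifiedField_apply hU.measurable hUi hε hε']
  have h := FunctionSpaces.Torus.norm_timeAvgWith_convolution_le_of_bound (hU.bound_apply i)
    (FunctionSpaces.Torus.integrable_deriv_timeBump_normed hτ) (FunctionSpaces.Torus.continuous_kernel hε hε') t x
  rwa [FunctionSpaces.Torus.integral_norm_deriv_timeBump_normed, FunctionSpaces.Torus.integral_norm_kernel_eq_one hε hε',
    mul_one] at h

/-- **`|∂ₗ∂ⱼVᵢ| ≤ C₂ ε⁻² M`**. [cite: BuckmasterVicol2019Annals, §2.5 (2.13)] -/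
theorem norm_partialDeriv_partialDeriv_mollifiedField_apply_le (hU : HolderSlabData U M H β T₀) (hτ : 0 < τ)
    (hε : 0 < ε) (hε' : ε ≤ 1 / 4) (t : ℝ) (x : UnitAddTorus d) (l j i : d) :
    ‖FunctionSpaces.Torus.partialDeriv l (FunctionSpaces.Torus.partialDeriv j (mollifiedField (timeBump hτ) ε U t)) x i‖ ≤
      (ε ^ 2)⁻¹ * derivProfileMass d 2 * M := by
  have hk : IsSmooth (kernel (d := d) ε) := FunctionSpaces.Torus.isSmooth_kernel hε hε'
  rw [partialDeriv_partialDeriv_mollifiedField_apply hU.measurable hU.bound hU.zero_off hε hε']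
  have h := FunctionSpaces.Torus.norm_timeAvgWith_convolution_le_of_bound (hU.bound_apply i)
    (timeBump hτ).integrable_normed ((hk.partialDeriv j).partialDeriv l).continuous t x
  rw [FunctionSpaces.Torus.integral_norm_timeBump_normed, one_mul] at h
  exact h.trans (mul_le_mul_of_nonneg_right
    (FunctionSpaces.Torus.integral_norm_partialDeriv_partialDeriv_kernel_le hε hε' l j) hU.M_nonneg)

/-- **`|∂ₜ∂ⱼVᵢ| ≤ c τ⁻¹ C₁ ε⁻¹ M`**. [cite: BuckmasterVicol2019Annals, §2.5 (2.13)] -/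
theorem norm_timeDeriv_partialDeriv_mollifiedField_apply_le (hU : HolderSlabData U M H β T₀) (hτ : 0 < τ)
    (hε : 0 < ε) (hε' : ε ≤ 1 / 4) (t : ℝ) (x : UnitAddTorus d) (j i : d) :
    ‖FunctionSpaces.Torus.timeDeriv (fun τ' y => FunctionSpaces.Torus.partialDeriv j (mollifiedField (timeBump hτ) ε U τ') y) t x i‖ ≤
      τ⁻¹ * timeBumpDerivMass * (ε⁻¹ * gradProfileMass d) * M := by
  have hk : IsSmooth (kernel (d := d) ε) := FunctionSpaces.Torus.isSmooth_kernel hε hε'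
  rw [timeDeriv_partialDeriv_mollifiedField_apply hU.measurable hU.bound hU.zero_off hε hε']
  have h := FunctionSpaces.Torus.norm_timeAvgWith_convolution_le_of_bound (hU.bound_apply i)
    (FunctionSpaces.Torus.integrable_deriv_timeBump_normed hτ) (hk.partialDeriv j).continuous t x
  rw [FunctionSpaces.Torus.integral_norm_deriv_timeBump_normed] at h
  exact h.trans (mul_le_mul_of_nonneg_right (mul_le_mul_of_nonneg_left
    (FunctionSpaces.Torus.integral_norm_partialDeriv_kernel_le hε hε' j)
    (mul_nonneg (inv_nonneg.2 hτ.le) FunctionSpaces.Torus.timeBumpDerivMass_nonneg)) hU.M_nonneg)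

/-! ### The flux -/

omit [DecidableEq d] in
/-- The columns `UⱼU` of bounded Hölder slab data are admissible data bounded by `M²`. [folklore] -/
theorem HolderSlabData.column (hU : HolderSlabData U M H β T₀) (j : d) :
    StronglyMeasurable (uncurry fun s y => U s y j • U s y) ∧ (∀ s y, ‖U s y j • U s y‖ ≤ M ^ 2) ∧
      ∀ s, s ∉ Icc 0 T₀ → (fun y => U s y j • U s y) = 0 :=
  ⟨stronglyMeasurable_uncurry_smul_apply hU.measurable j, norm_smul_apply_le hU.bound j,
    fun s hs => smul_apply_eq_zero_off hU.zero_off j s hs⟩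

omit [Fintype d] [DecidableEq d] in
/-- Entries of the columns: `(UⱼU)ᵢ = UⱼUᵢ`. [folklore] -/
theorem smul_apply_apply [Fintype d] (U : ℝ → UnitAddTorus d → EuclideanSpace ℝ d) (j i : d) (s : ℝ) (y : UnitAddTorus d) :
    (U s y j • U s y) i = U s y j * U s y i := by
  simp [smul_eq_mul]

omit [DecidableEq d] in
/-- **The first-order commutator bound** `|𝒯ⱼᵢ - VᵢVⱼ| ≤ 4 M H (max τ ε)^β` on windows inside the
slab: `𝒯ⱼᵢ - VᵢVⱼ = ℳ(UⱼUᵢ - VⱼVᵢ)(t, x)` (unit mass) and on the window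
`|UⱼUᵢ - VⱼVᵢ| ≤ M|Uᵢ - Vᵢ| + |Vᵢ||Uⱼ - Vⱼ| ≤ 4MH m^β` (Constantin–E–Titi re-centring; the
quadratic gain of (2.12) is not needed for Thm. 1.3 and not recorded).
[cite: BuckmasterVicol2019Annals, §2.5 (2.12)] -/
theorem norm_mollifiedFlux_sub_mul_le (hU : HolderSlabData U M H β T₀) (hτ : 0 < τ) (hε : 0 < ε)
    (hε' : ε ≤ 1 / 4) {t : ℝ} (ht : Icc (t - τ) (t + τ) ⊆ Icc 0 T₀) (x : UnitAddTorus d) (j i : d) :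
    ‖mollifiedFlux (timeBump hτ) ε U t x j i -
      mollifiedField (timeBump hτ) ε U t x j * mollifiedField (timeBump hτ) ε U t x i‖ ≤
      4 * M * H * max τ ε ^ β := by
  obtain ⟨hm, hb, h0⟩ := hU.column j
  have hUi' : Integrable (uncurry fun s y => U s y j • U s y) ((volume : Measure ℝ).prod volume) :=
    integrable_uncurry_of_bounded hm hb h0
  have hk := FunctionSpaces.Torus.continuous_kernel (d := d) hε hε'
  set a := mollifiedField (timeBump hτ) ε U t x j with ha
  set b := mollifiedField (timeBump hτ) ε U t x i with hb'
  have haM : ‖a‖ ≤ M := norm_mollifiedField_apply_le hU hτ hε hε' t x j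
  rw [mollifiedFlux_apply, mollifiedField_apply_eq_timeAvgWith hUi' hε hε']
  -- re-centre at the constant `a b`
  have hmji : StronglyMeasurable (uncurry fun s y => (U s y j • U s y) i) := stronglyMeasurable_uncurry_apply hm i
  have hbji : ∀ s y, ‖(U s y j • U s y) i‖ ≤ M ^ 2 := fun s y => (PiLp.norm_apply_le _ i).trans (hb s y)
  have hsub := FunctionSpaces.Torus.timeAvgWith_convolution_sub_const hmji hbji (timeBump hτ).integrable_normed hk
    (a * b) t x
  rw [(timeBump hτ).integral_normed, FunctionSpaces.Torus.integral_kernel hε hε', mul_one, mul_one] at hsub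
  rw [← hsub]
  -- the window bound
  have hwin : ∀ s y, |s - t| ≤ τ → ‖y - x‖ ≤ ε → ‖(U s y j • U s y) i - a * b‖ ≤ 4 * M * H * max τ ε ^ β := by
    intro s y hs hy
    rw [smul_apply_apply]
    have hj : ‖U s y j - a‖ ≤ 2 * (H * max τ ε ^ β) := by
      calc ‖U s y j - a‖ ≤ ‖U s y j - U t x j‖ + ‖U t x j - a‖ := norm_sub_le_norm_sub_add_norm_sub _ _ _
        _ ≤ H * max τ ε ^ β + H * max τ ε ^ β := add_le_add (hU.norm_apply_sub_le_of_window ht hτ.le hs hy j)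
            (by rw [norm_sub_rev]; exact norm_mollifiedField_apply_sub_le hU hτ hε hε' ht x j)
        _ = 2 * (H * max τ ε ^ β) := by ring
    have hi : ‖U s y i - b‖ ≤ 2 * (H * max τ ε ^ β) := by
      calc ‖U s y i - b‖ ≤ ‖U s y i - U t x i‖ + ‖U t x i - b‖ := norm_sub_le_norm_sub_add_norm_sub _ _ _
        _ ≤ H * max τ ε ^ β + H * max τ ε ^ β := add_le_add (hU.norm_apply_sub_le_of_window ht hτ.le hs hy i)
            (by rw [norm_sub_rev]; exact norm_mollifiedField_apply_sub_le hU hτ hε hε' ht x i)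
        _ = 2 * (H * max τ ε ^ β) := by ring
    have hsplit : U s y j * U s y i - a * b = U s y j * (U s y i - b) + (U s y j - a) * b := by ring
    rw [hsplit]
    calc ‖U s y j * (U s y i - b) + (U s y j - a) * b‖
        ≤ ‖U s y j‖ * ‖U s y i - b‖ + ‖U s y j - a‖ * ‖b‖ := by
          refine (norm_add_le _ _).trans (add_le_add ?_ ?_) <;> rw [norm_mul]
      _ ≤ M * (2 * (H * max τ ε ^ β)) + 2 * (H * max τ ε ^ β) * M :=
          add_le_add (mul_le_mul (hU.bound_apply j s y) hi (norm_nonneg _) hU.M_nonneg)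
            (mul_le_mul hj (norm_mollifiedField_apply_le hU hτ hε hε' t x i) (norm_nonneg _)
              (mul_nonneg zero_le_two (mul_nonneg hU.H_nonneg (Real.rpow_nonneg (le_max_of_le_left hτ.le) _))))
      _ = 4 * M * H * max τ ε ^ β := by ring
  have h := FunctionSpaces.Torus.norm_timeAvgWith_convolution_le_of_window
    (h := fun s y => (U s y j • U s y) i - a * b) (timeBump hτ).integrable_normed
    (fun σ hσ => (FunctionSpaces.Torus.timeBump_normed_eq_zero hτ hσ).1) hk
    (fun z hz => FunctionSpaces.Torus.kernel_eq_zero_of_lt hε hz) (t := t) (x := x) hwin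
  rwa [FunctionSpaces.Torus.integral_norm_timeBump_normed, FunctionSpaces.Torus.integral_norm_kernel_eq_one hε hε',
    one_mul, one_mul] at h

/-- **`|∂ₗ𝒯ⱼᵢ| ≤ C₁ ε⁻¹ M²`**. [cite: BuckmasterVicol2019Annals, §2.5 (2.13)] -/
theorem norm_partialDeriv_mollifiedFlux_apply_le (hU : HolderSlabData U M H β T₀) (hτ : 0 < τ) (hε : 0 < ε)
    (hε' : ε ≤ 1 / 4) (t : ℝ) (x : UnitAddTorus d) (l j i : d) :
    ‖FunctionSpaces.Torus.partialDeriv l (fun y => mollifiedFlux (timeBump hτ) ε U t y j) x i‖ ≤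
      ε⁻¹ * gradProfileMass d * M ^ 2 := by
  obtain ⟨hm, hb, h0⟩ := hU.column j
  have hk : IsSmooth (kernel (d := d) ε) := FunctionSpaces.Torus.isSmooth_kernel hε hε'
  have hfun : (fun y => mollifiedFlux (timeBump hτ) ε U t y j) = mollifiedField (timeBump hτ) ε (fun s y => U s y j • U s y) t := by
    funext y; rw [mollifiedFlux_apply]
  rw [hfun, partialDeriv_mollifiedField_apply hm hb h0 hε hε']
  have hbi : ∀ s y, ‖(U s y j • U s y) i‖ ≤ M ^ 2 := fun s y => (PiLp.norm_apply_le _ i).trans (hb s y)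
  have h := FunctionSpaces.Torus.norm_timeAvgWith_convolution_le_of_bound hbi (timeBump hτ).integrable_normed
    (hk.partialDeriv l).continuous t x
  rw [FunctionSpaces.Torus.integral_norm_timeBump_normed, one_mul] at h
  exact h.trans (mul_le_mul_of_nonneg_right (FunctionSpaces.Torus.integral_norm_partialDeriv_kernel_le hε hε' l)
    (by positivity))

omit [DecidableEq d] in
/-- **`|∂ₜ𝒯ⱼᵢ| ≤ c τ⁻¹ M²`**. [cite: BuckmasterVicol2019Annals, §2.5 (2.13)] -/
theorem norm_timeDeriv_mollifiedFlux_apply_le (hU : HolderSlabData U M H β T₀) (hτ : 0 < τ) (hε : 0 < ε)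
    (hε' : ε ≤ 1 / 4) (t : ℝ) (x : UnitAddTorus d) (j i : d) :
    ‖FunctionSpaces.Torus.timeDeriv (fun τ' y => mollifiedFlux (timeBump hτ) ε U τ' y j) t x i‖ ≤
      τ⁻¹ * timeBumpDerivMass * M ^ 2 := by
  obtain ⟨hm, hb, h0⟩ := hU.column j
  have hUi' : Integrable (uncurry fun s y => U s y j • U s y) ((volume : Measure ℝ).prod volume) :=
    integrable_uncurry_of_bounded hm hb h0
  have hfun : (fun τ' y => mollifiedFlux (timeBump hτ) ε U τ' y j) = mollifiedField (timeBump hτ) ε (fun s y => U s y j • U s y) := by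
    funext τ' y; rw [mollifiedFlux_apply]
  rw [hfun, timeDeriv_mollifiedField_apply hm hUi' hε hε']
  have hbi : ∀ s y, ‖(U s y j • U s y) i‖ ≤ M ^ 2 := fun s y => (PiLp.norm_apply_le _ i).trans (hb s y)
  have h := FunctionSpaces.Torus.norm_timeAvgWith_convolution_le_of_bound hbi
    (FunctionSpaces.Torus.integrable_deriv_timeBump_normed hτ) (FunctionSpaces.Torus.continuous_kernel hε hε') t x
  rwa [FunctionSpaces.Torus.integral_norm_deriv_timeBump_normed, FunctionSpaces.Torus.integral_norm_kernel_eq_one hε hε',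
    mul_one] at h

/-! ### Spatial translates and vector forms -/

omit [DecidableEq d] in
/-- **Translation**: `Vᵢ(t, x + δ)` is the space–time mollification, read at `x`, of the translated
data `(s, y) ↦ Uᵢ(s, y + δ)` (Haar invariance of the torus). [folklore] -/
theorem mollifiedField_apply_translate (hU : HolderSlabData U M H β T₀) (hτ : 0 < τ) (hε : 0 < ε)
    (hε' : ε ≤ 1 / 4) (t : ℝ) (x δ : UnitAddTorus d) (i : d) :
    mollifiedField (timeBump hτ) ε U t (x + δ) i =
      timeAvgWith ((timeBump hτ).normed volume) (fun s => (fun y => U s (y + δ) i) ⋆ kernel ε) t x := by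
  have hUi : Integrable (uncurry U) ((volume : Measure ℝ).prod volume) :=
    integrable_uncurry_of_bounded hU.measurable hU.bound hU.zero_off
  rw [mollifiedField_apply_eq_timeAvgWith hUi hε hε', FunctionSpaces.Torus.timeAvgWith_convolution_eq_integral,
    FunctionSpaces.Torus.timeAvgWith_convolution_eq_integral]
  refine integral_congr_ae (Eventually.of_forall fun s => ?_)
  simp only
  congr 1
  rw [← integral_add_right_eq_self (fun y => U s y i * kernel ε (x + δ - y)) δ]
  refine integral_congr_ae (Eventually.of_forall fun y => ?_)
  simp only
  congr 2
  abel

omit [DecidableEq d] in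
/-- **Spatial Hölder bound of the mollified field**: `|Vᵢ(t, x) - Vᵢ(t, x + δ)| ≤ H ‖δ‖^β` for every
`t` (mollification does not increase Hölder constants). [folklore] -/
theorem norm_mollifiedField_apply_sub_translate_le (hU : HolderSlabData U M H β T₀) (hτ : 0 < τ)
    (hε : 0 < ε) (hε' : ε ≤ 1 / 4) (t : ℝ) (x δ : UnitAddTorus d) (i : d) :
    ‖mollifiedField (timeBump hτ) ε U t x i - mollifiedField (timeBump hτ) ε U t (x + δ) i‖ ≤ H * ‖δ‖ ^ β := by
  have hUi : Integrable (uncurry U) ((volume : Measure ℝ).prod volume) :=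
    integrable_uncurry_of_bounded hU.measurable hU.bound hU.zero_off
  have hk := FunctionSpaces.Torus.continuous_kernel (d := d) hε hε'
  have hm₂ : StronglyMeasurable (uncurry fun s y => U s (y + δ) i) := by
    have h : StronglyMeasurable (uncurry fun s y => U s (y + δ)) :=
      hU.measurable.comp_measurable (measurable_fst.prodMk (measurable_snd.add_const δ))
    exact stronglyMeasurable_uncurry_apply h i
  rw [mollifiedField_apply_translate hU hτ hε hε', mollifiedField_apply_eq_timeAvgWith hUi hε hε',
    ← FunctionSpaces.Torus.timeAvgWith_convolution_sub (stronglyMeasurable_uncurry_apply hU.measurable i) (hU.bound_apply i)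
      hm₂ (fun s y => hU.bound_apply i s (y + δ)) (timeBump hτ).integrable_normed hk]
  have hbd : ∀ s y, ‖U s y i - U s (y + δ) i‖ ≤ H * ‖δ‖ ^ β := fun s y =>
    le_trans (by rw [← PiLp.sub_apply]; exact PiLp.norm_apply_le _ i) (hU.norm_sub_translate_le s y δ)
  have h := FunctionSpaces.Torus.norm_timeAvgWith_convolution_le_of_bound hbd (timeBump hτ).integrable_normed hk t x
  rwa [FunctionSpaces.Torus.integral_norm_timeBump_normed, FunctionSpaces.Torus.integral_norm_kernel_eq_one hε hε',
    one_mul, one_mul] at h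

/-- **Vector forms.** On windows inside the slab: `‖V(t, x)‖ ≤ (card d) M`,
`‖V(t, x) - U(t, x)‖ ≤ (card d) H (max τ ε)^β`, and for all `t`:
`‖V(t, x) - V(t, x + δ)‖ ≤ (card d) H ‖δ‖^β`. [folklore] -/
theorem norm_mollifiedField_bounds (hU : HolderSlabData U M H β T₀) (hτ : 0 < τ) (hε : 0 < ε) (hε' : ε ≤ 1 / 4) :
    (∀ t x, ‖mollifiedField (timeBump hτ) ε U t x‖ ≤ Fintype.card d * M) ∧
    (∀ t, Icc (t - τ) (t + τ) ⊆ Icc 0 T₀ → ∀ x,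
      ‖mollifiedField (timeBump hτ) ε U t x - U t x‖ ≤ Fintype.card d * (H * max τ ε ^ β)) ∧
    (∀ t x δ, ‖mollifiedField (timeBump hτ) ε U t x - mollifiedField (timeBump hτ) ε U t (x + δ)‖ ≤
      Fintype.card d * (H * ‖δ‖ ^ β)) := by
  refine ⟨fun t x => ?_, fun t ht x => ?_, fun t x δ => ?_⟩
  · refine (norm_le_sum_norm_apply _).trans ?_
    calc ∑ i, ‖mollifiedField (timeBump hτ) ε U t x i‖ ≤ ∑ _i : d, M :=
          Finset.sum_le_sum fun i _ => norm_mollifiedField_apply_le hU hτ hε hε' t x i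
      _ = Fintype.card d * M := by rw [Finset.sum_const, Finset.card_univ, nsmul_eq_mul]
  · refine (norm_le_sum_norm_apply _).trans ?_
    calc ∑ i, ‖(mollifiedField (timeBump hτ) ε U t x - U t x) i‖ ≤ ∑ _i : d, H * max τ ε ^ β :=
          Finset.sum_le_sum fun i _ => by
            rw [PiLp.sub_apply]; exact norm_mollifiedField_apply_sub_le hU hτ hε hε' ht x i
      _ = Fintype.card d * (H * max τ ε ^ β) := by rw [Finset.sum_const, Finset.card_univ, nsmul_eq_mul]
  · refine (norm_le_sum_norm_apply _).trans ?_
    calc ∑ i, ‖(mollifiedField (timeBump hτ) ε U t x - mollifiedField (timeBump hτ) ε U t (x + δ)) i‖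
          ≤ ∑ _i : d, H * ‖δ‖ ^ β := Finset.sum_le_sum fun i _ => by
            rw [PiLp.sub_apply]; exact norm_mollifiedField_apply_sub_translate_le hU hτ hε hε' t x δ i
      _ = Fintype.card d * (H * ‖δ‖ ^ β) := by rw [Finset.sum_const, Finset.card_univ, nsmul_eq_mul]

end Bounds


end Torus

end Literature.Analysis.FluidPDE

end
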